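import Literature.MathematicalPhysics.QuantumFieldTheory.Balaban1983to89.B8ExpMeanLogCrossTermTowerRec

/-!
# `Balaban1983to89.B8ExpMeanLogCrossTermGeomRec` — [Balaban1985Averaging] (79)–(80): the cross-term bound of the `j`-fold record average under GEOMETRICALLY DECAYING
# oscillations — `p_i + q_i ≤ s·θ^{j−1−i}` ⇒ `‖R̄₀ʲ(a·u)(y) − R̄₀ʲa(y)·R̄₀ʲu(y)‖ ≤ 1024·s²`, UNIFORMLY IN THE HEIGHT `j` (the explicit schedule of
# `B8ExpMeanLogCrossTermTowerRec.rbar_one_mul_sub_mul_le_tower`; the junction's closed form for road (B′)'s displayed defect `ψ₂`)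

statement-level skeleton of published theorems with citation tags; proofs where landed; nothing here is a claim about the Yang–Mills mass gap

CITATION HEADER (lean-in-tree rule).  Cell `pub-ymgap` (HUMAN RULING D-0062), the N05-REC → K0-road JUNCTION (width seat `pub-ymgap-dag-n07-w3` g13; dag-n05-e g41's
`ROAD-BPRIME.md` §3: «the junction supplies `p_i`, `q_i` and the schedule `E`; `ψ₂ = E_j`»).  [3] = [Balaban1985Averaging] (78)–(80) p. 30; [I] = [Balaban1987RG1] (0.3) p. 252.  (v1.2: the inherited tag «[15] (100) p. 47» dropped —
ref-L locator note, READ-873: CMP 102 (100) is the gauge condition on print p. 293, not this estimate's source.)  `--kind proof --supports stmt-QuantumFields-20541` (K0⁷; count-neutral; no definition).  REUSED BY NAME: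
`B8ExpMeanLogCrossTermTowerRec.rbar_one_mul_sub_mul_le_tower` (✓p746092), `B7Eq78Linearization.Rbar`, `B7SectEFLinearisationRec.{zdBlockingZ, bgTZ, blockSitesZ}`,
`B7SectCDGaugeAveragesRec.uavgZ`, `B8Eq119TwistedAxialRec.{UnderZ, underZ_zero_iff, underZ_one_block, underZ_one_centre}`, `B8ExpMeanLogCrossTermPertRec.norm_avgStep_sub_mul_le_of_near`,
`B8Eq178AveragesRec.{rbar_bgTZ_eq_uavgZ, smul_mem_blockSitesZ}`, `B8BlockConstantLiftStabilityRec.underZ_add`, `B8ExpMeanLogCrossTermTowerRec.sum_weights_blockSitesZ`.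

WHY.  The tower bound's schedule `E` is constrained by `E₀ = 0`, `E_i + 128(p_i + q_i + E_i)² ≤ E_{i+1}`, `p_i + q_i + E_i ≤ 1∕16`; since `E_{i+1} ≥ E_i + 128E_i²`, a schedule fed by
NON-decaying oscillations (`p_i + q_i ≡ s`) grows super-linearly and the constraints are satisfiable only for towers of bounded height — the resulting `ψ₂ = E_j` would depend on the
number of levels `j ≤ k ≤ m + K`, which the premise of record `HThm4RecSym152Phi … ψ` (ONE displayed real `ψ`) cannot absorb.  With oscillations decaying geometrically AWAY
FROM THE TOP, `p_i + q_i ≤ s·θ^{j−1−i}` (`θ ≤ 1∕2`; in the junction `θ = L⁻¹`, the in-block oscillation at level `i` of a field regular at the top scale `L^j`), the explicit schedule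
`E_i := 1024·s²·(θ^{2(j−i)} − θ^{2j})` closes the recursion under `1024·θ·s ≤ 1`, `s ≤ 1∕32`, and `E_j ≤ 1024·s²` is UNIFORM in `j`.  So the junction's `p_i`∕`q_i` suppliers must be
top-scale REGULARITY rows (this file fixes their shape), not closeness-to-`1` rows.

WHAT IS PROVED (sorry-free; real arithmetic + one application of the tower bound).  §1 `geomSchedule_nonneg`, `geomSchedule_zero`, `geomSchedule_le`, ★ `geomSchedule_step` (the
recursion inequality), `geomSchedule_small` (the `1∕16` row); §2 ★★★ `rbar_one_mul_sub_mul_le_geom` (all levels and all sites under the cell), ★★★ `rbar_one_mul_sub_mul_le_geom_at`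
(`‖R̄₀ʲ(a·u)(y) − R̄₀ʲa(y)·R̄₀ʲu(y)‖ ≤ 1024·s²`), ★★ `norm_rbar_one_mul_sub_one_le_geom` (with `R̄₀ʲa(y) = 1`, `R̄₀ʲu(y) = 1`: `‖R̄₀ʲ(a·u)(y) − 1‖ ≤ 1024·s²` — road (B′)'s row 9′ up
to `ψ₂ := 1024·s²`); §3 ★★★ `rbar_one_mul_sub_mul_le_tower_local` — ✓p746092's tower bound VERBATIM with its five `U1` rows LOCALISED to the block centres `L·z` under the cell (the only
sites its proof reads; the junction's fields are unitary but the series-`log` averages `uavgZ L 1` are provably `U1` only where the (78) families are small, i.e. under the window —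
the global rows `∀ i x` are not dischargeable there), ★★★ `rbar_one_mul_sub_mul_le_geom_local_at` ∕ ★★ `norm_rbar_one_mul_sub_one_le_geom_local` (the geometric schedule on it).
HONEST SCOPE.  Bookkeeping over the landed estimate; NO printed clause; the oscillation rows `hp`∕`hq` with their geometric decay and the `U1` rows remain the junction's inputs (NOT
produced here); `HThm4Rec*` CONDITIONAL; N05 DISCHARGED OF RECORD since R467 (count-neutral record-level work), N07 NOT discharged; counts unmoved (typed 28∕28 · discharged 8∕28);
one finite 𝕋⁴ programme at fixed ε — R4 closes the conditional finite-𝕋⁴ rung `BalabanLadder.UV` only; nothing continuum ∕ ℝ⁴ ∕ OS ∕ mass gap ∕ Clay.  No `def` (the schedule is written out, not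
named), no `instance`, no `notation`, no `sorry`.
-/

set_option autoImplicit false

noncomputable section

open scoped BigOperators

namespace Literature.MathematicalPhysics.QuantumFieldTheory.Balaban1983to89.B8ExpMeanLogCrossTermGeomRec

open B7Prop1Explicit hiding Site
open B7Prop1Explicit renaming Site → SiteZ
open B7Eq78Linearization (Rbar)
open B7SectEFLinearisationRec (zdBlockingZ bgTZ blockSitesZ)
open B7SectCDGaugeAveragesRec (uavgZ)
open B7Eq78Linearization (Rbar_zero Rbar_succ avgStep)
open B8Eq119TwistedAxialRec (UnderZ underZ_zero_iff underZ_one_block underZ_one_centre bgTZ_one)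
open B8Eq178AveragesRec (rbar_bgTZ_eq_uavgZ smul_mem_blockSitesZ)
open B8BlockConstantLiftStabilityRec (underZ_add)
open B8ExpMeanLogCrossTermPertRec (norm_avgStep_sub_mul_le_of_near)
open B8ExpMeanLogCrossTermTowerRec (rbar_one_mul_sub_mul_le_tower sum_weights_blockSitesZ)

variable {d : ℕ}

/-! ## §1  The geometric schedule `E_i = 1024·s²·(θ^{2(j−i)} − θ^{2j})` closes the recursion of the tower bound -/

section Schedule

variable {s θ : ℝ} {j : ℕ}

/-- The schedule is nonnegative (`0 ≤ θ ≤ 1`). [cite: Balaban1985Averaging, (79)–(80) p.30 (bookkeeping)] -/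
theorem geomSchedule_nonneg (hθ0 : 0 ≤ θ) (hθ1 : θ ≤ 1) (i : ℕ) : 0 ≤ 1024 * s ^ 2 * (θ ^ (2 * (j - i)) - θ ^ (2 * j)) := by
  have h : θ ^ (2 * j) ≤ θ ^ (2 * (j - i)) := pow_le_pow_of_le_one hθ0 hθ1 (by omega)
  have hs : 0 ≤ 1024 * s ^ 2 := by positivity
  exact mul_nonneg hs (sub_nonneg.2 h)

/-- `E₀ = 0`. [cite: Balaban1985Averaging, (79) p.30 (bookkeeping)] -/
theorem geomSchedule_zero : 1024 * s ^ 2 * (θ ^ (2 * (j - 0)) - θ ^ (2 * j)) = 0 := by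
  rw [Nat.sub_zero, sub_self, mul_zero]

/-- `E_i ≤ 1024·s²·θ^{2(j−i)} ≤ 1024·s²`. [cite: Balaban1985Averaging, (79)–(80) p.30 (bookkeeping)] -/
theorem geomSchedule_le (hθ0 : 0 ≤ θ) (hθ1 : θ ≤ 1) (i : ℕ) : 1024 * s ^ 2 * (θ ^ (2 * (j - i)) - θ ^ (2 * j)) ≤ 1024 * s ^ 2 := by
  have h1 : θ ^ (2 * (j - i)) ≤ 1 := pow_le_one₀ hθ0 hθ1
  have h2 : 0 ≤ θ ^ (2 * j) := pow_nonneg hθ0 _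
  have hs : 0 ≤ 1024 * s ^ 2 := by positivity
  nlinarith

/-- The key size estimate: for `i < j`, with `n = j − (i+1)`, an oscillation `x ≤ s·θⁿ` and the schedule value `E_i ≤ 1024·s²·θ^{2n+2}` add up to at most `2·s·θⁿ` when `1024·θ·s ≤ 1`.
[cite: Balaban1985Averaging, (79)–(80) p.30 (bookkeeping)] -/
theorem osc_add_schedule_le (hθ0 : 0 ≤ θ) (hθ1 : θ ≤ 1) (hs0 : 0 ≤ s) (hθs : 1024 * θ * s ≤ 1) {i : ℕ} (hij : i < j) {x : ℝ}
    (hx : x ≤ s * θ ^ (j - (i + 1))) : x + 1024 * s ^ 2 * (θ ^ (2 * (j - i)) - θ ^ (2 * j)) ≤ 2 * (s * θ ^ (j - (i + 1))) := by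
  set n := j - (i + 1) with hn
  have hji : j - i = n + 1 := by omega
  have ht0 : 0 ≤ θ ^ n := pow_nonneg hθ0 _
  have ht1 : θ ^ n ≤ 1 := pow_le_one₀ hθ0 hθ1
  -- `E_i ≤ 1024 s² θ^{2n+2} = (1024 θ s)·(θ^{n+1})·(s θ^n) ≤ s θ^n`
  have hE : 1024 * s ^ 2 * (θ ^ (2 * (j - i)) - θ ^ (2 * j)) ≤ s * θ ^ n := by
    rw [hji]
    have h2j : 0 ≤ θ ^ (2 * j) := pow_nonneg hθ0 _
    have hpow : θ ^ (2 * (n + 1)) = θ ^ n * θ ^ n * (θ * θ) := by ring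
    have hθn1 : θ ^ n * θ ≤ 1 := by nlinarith
    calc 1024 * s ^ 2 * (θ ^ (2 * (n + 1)) - θ ^ (2 * j)) ≤ 1024 * s ^ 2 * θ ^ (2 * (n + 1)) := by nlinarith [sq_nonneg s]
      _ = (1024 * θ * s) * (θ ^ n * θ) * (s * θ ^ n) := by rw [hpow]; ring
      _ ≤ 1 * 1 * (s * θ ^ n) := by
          apply mul_le_mul (mul_le_mul hθs hθn1 (by positivity) zero_le_one) le_rfl (by positivity) (by positivity)
      _ = s * θ ^ n := by ring
  linarith

/-- ★ **THE RECURSION ROW**: for `i < j`, `E_i + 128(p_i + q_i + E_i)² ≤ E_{i+1}` whenever `p_i + q_i ≤ s·θ^{j−1−i}`, `0 ≤ θ ≤ 1∕2`, `0 ≤ s`, `1024·θ·s ≤ 1` (the increment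
`E_{i+1} − E_i = 1024·s²·θ^{2n}(1 − θ²) ≥ 768·s²·θ^{2n}` dominates `128·(2sθⁿ)² = 512·s²·θ^{2n}`). [cite: Balaban1985Averaging, (79)–(80) p.30 (bookkeeping)] -/
theorem geomSchedule_step (hθ0 : 0 ≤ θ) (hθ2 : θ ≤ 1 / 2) (hs0 : 0 ≤ s) (hθs : 1024 * θ * s ≤ 1) {i : ℕ} (hij : i < j) {x : ℝ} (hx0 : 0 ≤ x)
    (hx : x ≤ s * θ ^ (j - (i + 1))) :
    1024 * s ^ 2 * (θ ^ (2 * (j - i)) - θ ^ (2 * j)) + 128 * (x + 1024 * s ^ 2 * (θ ^ (2 * (j - i)) - θ ^ (2 * j))) ^ 2 ≤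
      1024 * s ^ 2 * (θ ^ (2 * (j - (i + 1))) - θ ^ (2 * j)) := by
  have hθ1 : θ ≤ 1 := hθ2.trans (by norm_num)
  set n := j - (i + 1) with hn
  have hji : j - i = n + 1 := by omega
  have hsum := osc_add_schedule_le hθ0 hθ1 hs0 hθs hij hx
  have hE0 : 0 ≤ 1024 * s ^ 2 * (θ ^ (2 * (j - i)) - θ ^ (2 * j)) := geomSchedule_nonneg hθ0 hθ1 i
  have hX0 : 0 ≤ x + 1024 * s ^ 2 * (θ ^ (2 * (j - i)) - θ ^ (2 * j)) := add_nonneg hx0 hE0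
  -- square of the sum ≤ 4 s² θ^{2n}
  have hsq : (x + 1024 * s ^ 2 * (θ ^ (2 * (j - i)) - θ ^ (2 * j))) ^ 2 ≤ (2 * (s * θ ^ n)) ^ 2 :=
    pow_le_pow_left₀ hX0 hsum 2
  have hpow2 : (2 * (s * θ ^ n)) ^ 2 = 4 * s ^ 2 * θ ^ (2 * n) := by ring
  rw [hpow2] at hsq
  -- so the quadratic term is at most `512 s² θ^{2n}`
  have h128 : 128 * (x + 1024 * s ^ 2 * (θ ^ (2 * (j - i)) - θ ^ (2 * j))) ^ 2 ≤ 512 * s ^ 2 * θ ^ (2 * n) := by linarith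
  -- and the increment `E_{i+1} − E_i = 1024 s² θ^{2n}(1 − θ²) ≥ 768 s² θ^{2n}` dominates it
  have ht2n : 0 ≤ θ ^ (2 * n) := pow_nonneg hθ0 _
  have hθsq : θ * θ ≤ 1 / 4 := by nlinarith
  have hpow1 : θ ^ (2 * (j - i)) = θ ^ (2 * n) * (θ * θ) := by rw [hji]; ring
  have hst : 0 ≤ s ^ 2 * θ ^ (2 * n) := mul_nonneg (sq_nonneg s) ht2n
  have hkey : s ^ 2 * (θ ^ (2 * n) * (θ * θ)) ≤ s ^ 2 * θ ^ (2 * n) * (1 / 4) := by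
    rw [← mul_assoc]; exact mul_le_mul_of_nonneg_left hθsq hst
  rw [hpow1]
  rw [hpow1] at h128
  linarith

/-- The `1∕16` row: `p_i + q_i + E_i ≤ 2s ≤ 1∕16` for `s ≤ 1∕32`. [cite: Balaban1985Averaging, (79)–(80) p.30 (bookkeeping)] -/
theorem geomSchedule_small (hθ0 : 0 ≤ θ) (hθ1 : θ ≤ 1) (hs0 : 0 ≤ s) (hs32 : s ≤ 1 / 32) (hθs : 1024 * θ * s ≤ 1) {i : ℕ} (hij : i < j) {x : ℝ}
    (hx : x ≤ s * θ ^ (j - (i + 1))) : x + 1024 * s ^ 2 * (θ ^ (2 * (j - i)) - θ ^ (2 * j)) ≤ 1 / 16 := by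
  have hsum := osc_add_schedule_le hθ0 hθ1 hs0 hθs hij hx
  have ht1 : θ ^ (j - (i + 1)) ≤ 1 := pow_le_one₀ hθ0 hθ1
  nlinarith

end Schedule

/-! ## §2  The tower bound under geometric decay: `ψ₂ ≤ 1024·s²`, uniformly in the height -/

variable {𝔸 : Type*} [NormedRing 𝔸] [NormOneClass 𝔸] [NormedAlgebra ℂ 𝔸] [CompleteSpace 𝔸]

/-- ★★★ **THE CROSS-TERM BOUND UNDER GEOMETRICALLY DECAYING OSCILLATIONS** ([3] (79)–(80), centred record blocking, trivial background, odd `L`): if the per-level in-block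
oscillations of `R̄₀ⁱa`, `R̄₀ⁱu` under the cell `y` satisfy `p_i + q_i ≤ s·θ^{j−1−i}` (`0 ≤ θ ≤ 1∕2`, `0 ≤ s ≤ 1∕32`, `1024·θ·s ≤ 1`) and the three towers are `U1`-bounded, then for every
`i ≤ j` and every `z` under `y` at depth `j − i`: `‖R̄₀ⁱ(a·u)(z) − R̄₀ⁱa(z)·R̄₀ⁱu(z)‖ ≤ 1024·s²·(θ^{2(j−i)} − θ^{2j})` — the tower bound with the explicit schedule of §1.
[cite: Balaban1985Averaging, (78)–(80) p.30; Balaban1987RG1, (0.3) p.252] -/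
theorem rbar_one_mul_sub_mul_le_geom {L : ℕ} (hL : Odd L) (a u : SiteZ d → 𝔸ˣ) (j : ℕ) (y : SiteZ d) (p q : ℕ → ℝ) {s θ : ℝ}
    (hp0 : ∀ i, 0 ≤ p i) (hq0 : ∀ i, 0 ≤ q i) (hθ0 : 0 ≤ θ) (hθ2 : θ ≤ 1 / 2) (hs0 : 0 ≤ s) (hs32 : s ≤ 1 / 32) (hθs : 1024 * θ * s ≤ 1)
    (hpq : ∀ i, i < j → p i + q i ≤ s * θ ^ (j - (i + 1)))
    (ha1 : ∀ i x, ‖((uavgZ L (1 : SiteZ d → Fin d → 𝔸ˣ) a i x : 𝔸ˣ) : 𝔸)‖ ≤ 1)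
    (hu1 : ∀ i x, ‖((uavgZ L (1 : SiteZ d → Fin d → 𝔸ˣ) u i x : 𝔸ˣ) : 𝔸)‖ ≤ 1)
    (hu1' : ∀ i x, ‖(((uavgZ L (1 : SiteZ d → Fin d → 𝔸ˣ) u i x)⁻¹ : 𝔸ˣ) : 𝔸)‖ ≤ 1)
    (hw1' : ∀ i x, ‖(((uavgZ L (1 : SiteZ d → Fin d → 𝔸ˣ) (a * u) i x)⁻¹ : 𝔸ˣ) : 𝔸)‖ ≤ 1)
    (ha1' : ∀ i x, ‖(((uavgZ L (1 : SiteZ d → Fin d → 𝔸ˣ) a i x)⁻¹ : 𝔸ˣ) : 𝔸)‖ ≤ 1)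
    (hp : ∀ i, i < j → ∀ z, UnderZ L (j - (i + 1)) y z → ∀ x ∈ blockSitesZ L z,
      ‖(((uavgZ L (1 : SiteZ d → Fin d → 𝔸ˣ) a i ((L : ℤ) • z))⁻¹ : 𝔸ˣ) : 𝔸) * ((uavgZ L (1 : SiteZ d → Fin d → 𝔸ˣ) a i x : 𝔸ˣ) : 𝔸) - 1‖ ≤ p i)
    (hq : ∀ i, i < j → ∀ z, UnderZ L (j - (i + 1)) y z → ∀ x ∈ blockSitesZ L z,
      ‖(((uavgZ L (1 : SiteZ d → Fin d → 𝔸ˣ) u i ((L : ℤ) • z))⁻¹ : 𝔸ˣ) : 𝔸) * ((uavgZ L (1 : SiteZ d → Fin d → 𝔸ˣ) u i x : 𝔸ˣ) : 𝔸) - 1‖ ≤ q i) :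
    ∀ i, i ≤ j → ∀ z, UnderZ L (j - i) y z →
      ‖Rbar (zdBlockingZ d L) (bgTZ L (1 : SiteZ d → Fin d → 𝔸ˣ)) i (fun x => (((a * u) x : 𝔸ˣ) : 𝔸)) z -
        Rbar (zdBlockingZ d L) (bgTZ L (1 : SiteZ d → Fin d → 𝔸ˣ)) i (fun x => ((a x : 𝔸ˣ) : 𝔸)) z *
          Rbar (zdBlockingZ d L) (bgTZ L (1 : SiteZ d → Fin d → 𝔸ˣ)) i (fun x => ((u x : 𝔸ˣ) : 𝔸)) z‖ ≤ 1024 * s ^ 2 * (θ ^ (2 * (j - i)) - θ ^ (2 * j)) := by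
  have hθ1 : θ ≤ 1 := hθ2.trans (by norm_num)
  refine rbar_one_mul_sub_mul_le_tower hL a u j y p q (fun i => 1024 * s ^ 2 * (θ ^ (2 * (j - i)) - θ ^ (2 * j))) hp0 hq0
    geomSchedule_zero (geomSchedule_nonneg hθ0 hθ1) (fun i hij => ?_) (fun i hij => ?_) ha1 hu1 hu1' hw1' ha1' hp hq
  · exact geomSchedule_step hθ0 hθ2 hs0 hθs hij (add_nonneg (hp0 i) (hq0 i)) (hpq i hij)
  · exact geomSchedule_small hθ0 hθ1 hs0 hs32 hθs hij (hpq i hij)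

/-- ★★★ **AT THE CELL**: `‖R̄₀ʲ(a·u)(y) − R̄₀ʲa(y)·R̄₀ʲu(y)‖ ≤ 1024·s²` — UNIFORM in the height `j` (same hypotheses).
[cite: Balaban1985Averaging, (78)–(80) p.30; Balaban1987RG1, (0.3) p.252] -/
theorem rbar_one_mul_sub_mul_le_geom_at {L : ℕ} (hL : Odd L) (a u : SiteZ d → 𝔸ˣ) (j : ℕ) (y : SiteZ d) (p q : ℕ → ℝ) {s θ : ℝ}
    (hp0 : ∀ i, 0 ≤ p i) (hq0 : ∀ i, 0 ≤ q i) (hθ0 : 0 ≤ θ) (hθ2 : θ ≤ 1 / 2) (hs0 : 0 ≤ s) (hs32 : s ≤ 1 / 32) (hθs : 1024 * θ * s ≤ 1)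
    (hpq : ∀ i, i < j → p i + q i ≤ s * θ ^ (j - (i + 1)))
    (ha1 : ∀ i x, ‖((uavgZ L (1 : SiteZ d → Fin d → 𝔸ˣ) a i x : 𝔸ˣ) : 𝔸)‖ ≤ 1)
    (hu1 : ∀ i x, ‖((uavgZ L (1 : SiteZ d → Fin d → 𝔸ˣ) u i x : 𝔸ˣ) : 𝔸)‖ ≤ 1)
    (hu1' : ∀ i x, ‖(((uavgZ L (1 : SiteZ d → Fin d → 𝔸ˣ) u i x)⁻¹ : 𝔸ˣ) : 𝔸)‖ ≤ 1)
    (hw1' : ∀ i x, ‖(((uavgZ L (1 : SiteZ d → Fin d → 𝔸ˣ) (a * u) i x)⁻¹ : 𝔸ˣ) : 𝔸)‖ ≤ 1)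
    (ha1' : ∀ i x, ‖(((uavgZ L (1 : SiteZ d → Fin d → 𝔸ˣ) a i x)⁻¹ : 𝔸ˣ) : 𝔸)‖ ≤ 1)
    (hp : ∀ i, i < j → ∀ z, UnderZ L (j - (i + 1)) y z → ∀ x ∈ blockSitesZ L z,
      ‖(((uavgZ L (1 : SiteZ d → Fin d → 𝔸ˣ) a i ((L : ℤ) • z))⁻¹ : 𝔸ˣ) : 𝔸) * ((uavgZ L (1 : SiteZ d → Fin d → 𝔸ˣ) a i x : 𝔸ˣ) : 𝔸) - 1‖ ≤ p i)
    (hq : ∀ i, i < j → ∀ z, UnderZ L (j - (i + 1)) y z → ∀ x ∈ blockSitesZ L z,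
      ‖(((uavgZ L (1 : SiteZ d → Fin d → 𝔸ˣ) u i ((L : ℤ) • z))⁻¹ : 𝔸ˣ) : 𝔸) * ((uavgZ L (1 : SiteZ d → Fin d → 𝔸ˣ) u i x : 𝔸ˣ) : 𝔸) - 1‖ ≤ q i) :
    ‖Rbar (zdBlockingZ d L) (bgTZ L (1 : SiteZ d → Fin d → 𝔸ˣ)) j (fun x => (((a * u) x : 𝔸ˣ) : 𝔸)) y -
      Rbar (zdBlockingZ d L) (bgTZ L (1 : SiteZ d → Fin d → 𝔸ˣ)) j (fun x => ((a x : 𝔸ˣ) : 𝔸)) y *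
        Rbar (zdBlockingZ d L) (bgTZ L (1 : SiteZ d → Fin d → 𝔸ˣ)) j (fun x => ((u x : 𝔸ˣ) : 𝔸)) y‖ ≤ 1024 * s ^ 2 := by
  have hθ1 : θ ≤ 1 := hθ2.trans (by norm_num)
  have h := rbar_one_mul_sub_mul_le_geom hL a u j y p q hp0 hq0 hθ0 hθ2 hs0 hs32 hθs hpq ha1 hu1 hu1' hw1' ha1' hp hq j le_rfl y
    (by rw [Nat.sub_self]; exact (underZ_zero_iff L y y).2 rfl)
  exact h.trans (geomSchedule_le hθ0 hθ1 j)

/-- ★★ **ROAD (B′)'s ROW 9′ UP TO `ψ₂ := 1024·s²`**: if moreover `R̄₀ʲa(y) = 1` (right covariance at the cell datum, `B8BlockConstantLiftDataRec.rbar_one_mul_blockConstant_eq_one`) and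
`R̄₀ʲu(y) = 1` (Theorem 4's (1.29) normalisation of `u₀`), then `‖R̄₀ʲ(a·u)(y) − 1‖ ≤ 1024·s²`, uniformly in `j`.
[cite: Balaban1985Averaging, (78)–(81) p.30; Balaban1985RegularSpaces, (1.29) p.81; Balaban1987RG1, (0.3) p.252] -/
theorem norm_rbar_one_mul_sub_one_le_geom {L : ℕ} (hL : Odd L) (a u : SiteZ d → 𝔸ˣ) (j : ℕ) (y : SiteZ d) (p q : ℕ → ℝ) {s θ : ℝ}
    (hp0 : ∀ i, 0 ≤ p i) (hq0 : ∀ i, 0 ≤ q i) (hθ0 : 0 ≤ θ) (hθ2 : θ ≤ 1 / 2) (hs0 : 0 ≤ s) (hs32 : s ≤ 1 / 32) (hθs : 1024 * θ * s ≤ 1)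
    (hpq : ∀ i, i < j → p i + q i ≤ s * θ ^ (j - (i + 1)))
    (ha1 : ∀ i x, ‖((uavgZ L (1 : SiteZ d → Fin d → 𝔸ˣ) a i x : 𝔸ˣ) : 𝔸)‖ ≤ 1)
    (hu1 : ∀ i x, ‖((uavgZ L (1 : SiteZ d → Fin d → 𝔸ˣ) u i x : 𝔸ˣ) : 𝔸)‖ ≤ 1)
    (hu1' : ∀ i x, ‖(((uavgZ L (1 : SiteZ d → Fin d → 𝔸ˣ) u i x)⁻¹ : 𝔸ˣ) : 𝔸)‖ ≤ 1)
    (hw1' : ∀ i x, ‖(((uavgZ L (1 : SiteZ d → Fin d → 𝔸ˣ) (a * u) i x)⁻¹ : 𝔸ˣ) : 𝔸)‖ ≤ 1)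
    (ha1' : ∀ i x, ‖(((uavgZ L (1 : SiteZ d → Fin d → 𝔸ˣ) a i x)⁻¹ : 𝔸ˣ) : 𝔸)‖ ≤ 1)
    (hp : ∀ i, i < j → ∀ z, UnderZ L (j - (i + 1)) y z → ∀ x ∈ blockSitesZ L z,
      ‖(((uavgZ L (1 : SiteZ d → Fin d → 𝔸ˣ) a i ((L : ℤ) • z))⁻¹ : 𝔸ˣ) : 𝔸) * ((uavgZ L (1 : SiteZ d → Fin d → 𝔸ˣ) a i x : 𝔸ˣ) : 𝔸) - 1‖ ≤ p i)
    (hq : ∀ i, i < j → ∀ z, UnderZ L (j - (i + 1)) y z → ∀ x ∈ blockSitesZ L z,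
      ‖(((uavgZ L (1 : SiteZ d → Fin d → 𝔸ˣ) u i ((L : ℤ) • z))⁻¹ : 𝔸ˣ) : 𝔸) * ((uavgZ L (1 : SiteZ d → Fin d → 𝔸ˣ) u i x : 𝔸ˣ) : 𝔸) - 1‖ ≤ q i)
    (ha : Rbar (zdBlockingZ d L) (bgTZ L (1 : SiteZ d → Fin d → 𝔸ˣ)) j (fun x => ((a x : 𝔸ˣ) : 𝔸)) y = 1)
    (hu : Rbar (zdBlockingZ d L) (bgTZ L (1 : SiteZ d → Fin d → 𝔸ˣ)) j (fun x => ((u x : 𝔸ˣ) : 𝔸)) y = 1) :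
    ‖Rbar (zdBlockingZ d L) (bgTZ L (1 : SiteZ d → Fin d → 𝔸ˣ)) j (fun x => (((a * u) x : 𝔸ˣ) : 𝔸)) y - 1‖ ≤ 1024 * s ^ 2 := by
  have h := rbar_one_mul_sub_mul_le_geom_at hL a u j y p q hp0 hq0 hθ0 hθ2 hs0 hs32 hθs hpq ha1 hu1 hu1' hw1' ha1' hp hq
  rwa [ha, hu, mul_one] at h

/-! ## §3  The tower bound with the `U1` rows LOCALISED under the cell (✓p746092's proof reads the centres `L·z` under `y` only) -/

omit [NormOneClass 𝔸] [NormedAlgebra ℂ 𝔸] [CompleteSpace 𝔸] in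
/-- `‖x⁻¹w − 1‖ ≤ E` from `‖w − x‖ ≤ E` and `‖x⁻¹‖ ≤ 1`. [folklore] -/
private theorem norm_inv_mul_sub_one_le' {x w : 𝔸ˣ} {E : ℝ} (hx : ‖((x⁻¹ : 𝔸ˣ) : 𝔸)‖ ≤ 1) (h : ‖(w : 𝔸) - (x : 𝔸)‖ ≤ E) :
    ‖((x⁻¹ : 𝔸ˣ) : 𝔸) * (w : 𝔸) - 1‖ ≤ E := by
  have hrew : ((x⁻¹ : 𝔸ˣ) : 𝔸) * (w : 𝔸) - 1 = ((x⁻¹ : 𝔸ˣ) : 𝔸) * ((w : 𝔸) - (x : 𝔸)) := by rw [mul_sub, Units.inv_mul]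
  rw [hrew]
  calc ‖((x⁻¹ : 𝔸ˣ) : 𝔸) * ((w : 𝔸) - (x : 𝔸))‖ ≤ ‖((x⁻¹ : 𝔸ˣ) : 𝔸)‖ * ‖(w : 𝔸) - (x : 𝔸)‖ := norm_mul_le _ _
    _ ≤ 1 * E := by gcongr
    _ = E := one_mul E

/-- ★★★ **THE CROSS-TERM BOUND, TOWER FORM, `U1` ROWS LOCALISED** ([3] (79)–(80), centred record blocking, trivial background, odd `L`): dag-n05-e's `rbar_one_mul_sub_mul_le_tower`
(✓p746092) VERBATIM except that the five `U1` rows are asked only at the block CENTRES `L·z` of the sites `z` under the cell `y` at depth `j − (i+1)`, `i < j` — the only sites the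
one-step lemma `norm_avgStep_sub_mul_le_of_near` reads them at (base values).  (The junction's `a = g_sr·X⁻¹` and `u = u₀` are unitary, but the series-logarithm averages `uavgZ L 1` are
unitary — hence `U1` — only where the (78) families stay inside the logarithm's disc, which the Landau rows give under the window and nowhere else.)
[cite: Balaban1985Averaging, (78)–(80) p.30; Balaban1987RG1, (0.3) p.252] -/
theorem rbar_one_mul_sub_mul_le_tower_local {L : ℕ} (hL : Odd L) (a u : SiteZ d → 𝔸ˣ) (j : ℕ) (y : SiteZ d) (p q E : ℕ → ℝ)
    (hp0 : ∀ i, 0 ≤ p i) (hq0 : ∀ i, 0 ≤ q i) (hE0 : E 0 = 0) (hEn : ∀ i, 0 ≤ E i)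
    (hE : ∀ i, i < j → E i + 128 * (p i + q i + E i) ^ 2 ≤ E (i + 1)) (hsm : ∀ i, i < j → p i + q i + E i ≤ 1 / 16)
    -- `U1` bounds on the three towers of averages AT THE CENTRES UNDER THE CELL
    (ha1 : ∀ i, i < j → ∀ z, UnderZ L (j - (i + 1)) y z → ‖((uavgZ L (1 : SiteZ d → Fin d → 𝔸ˣ) a i ((L : ℤ) • z) : 𝔸ˣ) : 𝔸)‖ ≤ 1)
    (hu1 : ∀ i, i < j → ∀ z, UnderZ L (j - (i + 1)) y z → ‖((uavgZ L (1 : SiteZ d → Fin d → 𝔸ˣ) u i ((L : ℤ) • z) : 𝔸ˣ) : 𝔸)‖ ≤ 1)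
    (hu1' : ∀ i, i < j → ∀ z, UnderZ L (j - (i + 1)) y z → ‖(((uavgZ L (1 : SiteZ d → Fin d → 𝔸ˣ) u i ((L : ℤ) • z))⁻¹ : 𝔸ˣ) : 𝔸)‖ ≤ 1)
    (hw1' : ∀ i, i < j → ∀ z, UnderZ L (j - (i + 1)) y z → ‖(((uavgZ L (1 : SiteZ d → Fin d → 𝔸ˣ) (a * u) i ((L : ℤ) • z))⁻¹ : 𝔸ˣ) : 𝔸)‖ ≤ 1)
    (ha1' : ∀ i, i < j → ∀ z, UnderZ L (j - (i + 1)) y z → ‖(((uavgZ L (1 : SiteZ d → Fin d → 𝔸ˣ) a i ((L : ℤ) • z))⁻¹ : 𝔸ˣ) : 𝔸)‖ ≤ 1)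
    -- per-level oscillations inside the blocks under `y`
    (hp : ∀ i, i < j → ∀ z, UnderZ L (j - (i + 1)) y z → ∀ x ∈ blockSitesZ L z,
      ‖(((uavgZ L (1 : SiteZ d → Fin d → 𝔸ˣ) a i ((L : ℤ) • z))⁻¹ : 𝔸ˣ) : 𝔸) * ((uavgZ L (1 : SiteZ d → Fin d → 𝔸ˣ) a i x : 𝔸ˣ) : 𝔸) - 1‖ ≤ p i)
    (hq : ∀ i, i < j → ∀ z, UnderZ L (j - (i + 1)) y z → ∀ x ∈ blockSitesZ L z,
      ‖(((uavgZ L (1 : SiteZ d → Fin d → 𝔸ˣ) u i ((L : ℤ) • z))⁻¹ : 𝔸ˣ) : 𝔸) * ((uavgZ L (1 : SiteZ d → Fin d → 𝔸ˣ) u i x : 𝔸ˣ) : 𝔸) - 1‖ ≤ q i) :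
    ∀ i, i ≤ j → ∀ z, UnderZ L (j - i) y z →
      ‖Rbar (zdBlockingZ d L) (bgTZ L (1 : SiteZ d → Fin d → 𝔸ˣ)) i (fun x => (((a * u) x : 𝔸ˣ) : 𝔸)) z -
        Rbar (zdBlockingZ d L) (bgTZ L (1 : SiteZ d → Fin d → 𝔸ˣ)) i (fun x => ((a x : 𝔸ˣ) : 𝔸)) z *
          Rbar (zdBlockingZ d L) (bgTZ L (1 : SiteZ d → Fin d → 𝔸ˣ)) i (fun x => ((u x : 𝔸ˣ) : 𝔸)) z‖ ≤ E i := by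
  obtain ⟨s, hs⟩ := hL
  have hLs : L = 2 * s + 1 := hs
  have hL1 : 1 ≤ L := by omega
  intro i
  induction i with
  | zero =>
    intro _ z _
    rw [Rbar_zero, Rbar_zero, Rbar_zero, Pi.mul_apply, Units.val_mul, sub_self, norm_zero, hE0]
  | succ i IH =>
    intro hi z hz
    have hij : i < j := by omega
    -- every block site of `z` is under `y` at depth `j − i`
    have hunder : ∀ x ∈ blockSitesZ L z, UnderZ L (j - i) y x := by
      intro x hx
      obtain ⟨r, rfl⟩ := B7SectEFLinearisationRec.mem_blockSitesZ.1 hx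
      have := underZ_add ⟨s, hs⟩ hz (underZ_one_block hLs z r)
      rwa [show j - (i + 1) + 1 = j - i by omega] at this
    have IH' : ∀ x ∈ blockSitesZ L z,
        ‖Rbar (zdBlockingZ d L) (bgTZ L (1 : SiteZ d → Fin d → 𝔸ˣ)) i (fun x => (((a * u) x : 𝔸ˣ) : 𝔸)) x -
          Rbar (zdBlockingZ d L) (bgTZ L (1 : SiteZ d → Fin d → 𝔸ˣ)) i (fun x => ((a x : 𝔸ˣ) : 𝔸)) x *
            Rbar (zdBlockingZ d L) (bgTZ L (1 : SiteZ d → Fin d → 𝔸ˣ)) i (fun x => ((u x : 𝔸ˣ) : 𝔸)) x‖ ≤ E i :=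
      fun x hx => IH hij.le x (hunder x hx)
    -- the three averages as unit-valued towers
    have hRa := rbar_bgTZ_eq_uavgZ L (1 : SiteZ d → Fin d → 𝔸ˣ) a i
    have hRu := rbar_bgTZ_eq_uavgZ L (1 : SiteZ d → Fin d → 𝔸ˣ) u i
    have hRw := rbar_bgTZ_eq_uavgZ L (1 : SiteZ d → Fin d → 𝔸ˣ) (a * u) i
    rw [Rbar_succ, Rbar_succ, Rbar_succ]
    show ‖avgStep (blockSitesZ L z) (fun _ => ((L : ℝ) ^ d)⁻¹) (bgTZ L (1 : SiteZ d → Fin d → 𝔸ˣ) i z)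
          (Rbar (zdBlockingZ d L) (bgTZ L (1 : SiteZ d → Fin d → 𝔸ˣ)) i (fun x => (((a * u) x : 𝔸ˣ) : 𝔸)) ((L : ℤ) • z))
          (Rbar (zdBlockingZ d L) (bgTZ L (1 : SiteZ d → Fin d → 𝔸ˣ)) i (fun x => (((a * u) x : 𝔸ˣ) : 𝔸))) -
        avgStep (blockSitesZ L z) (fun _ => ((L : ℝ) ^ d)⁻¹) (bgTZ L (1 : SiteZ d → Fin d → 𝔸ˣ) i z)
          (Rbar (zdBlockingZ d L) (bgTZ L (1 : SiteZ d → Fin d → 𝔸ˣ)) i (fun x => ((a x : 𝔸ˣ) : 𝔸)) ((L : ℤ) • z))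
          (Rbar (zdBlockingZ d L) (bgTZ L (1 : SiteZ d → Fin d → 𝔸ˣ)) i (fun x => ((a x : 𝔸ˣ) : 𝔸))) *
        avgStep (blockSitesZ L z) (fun _ => ((L : ℝ) ^ d)⁻¹) (bgTZ L (1 : SiteZ d → Fin d → 𝔸ˣ) i z)
          (Rbar (zdBlockingZ d L) (bgTZ L (1 : SiteZ d → Fin d → 𝔸ˣ)) i (fun x => ((u x : 𝔸ˣ) : 𝔸)) ((L : ℤ) • z))
          (Rbar (zdBlockingZ d L) (bgTZ L (1 : SiteZ d → Fin d → 𝔸ˣ)) i (fun x => ((u x : 𝔸ˣ) : 𝔸)))‖ ≤ E (i + 1)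
    -- base values are the units `uavgZ … (L·z)`
    have hbw : Rbar (zdBlockingZ d L) (bgTZ L (1 : SiteZ d → Fin d → 𝔸ˣ)) i (fun x => (((a * u) x : 𝔸ˣ) : 𝔸)) ((L : ℤ) • z) =
        ((uavgZ L (1 : SiteZ d → Fin d → 𝔸ˣ) (a * u) i ((L : ℤ) • z) : 𝔸ˣ) : 𝔸) := by rw [hRw]
    have hba : Rbar (zdBlockingZ d L) (bgTZ L (1 : SiteZ d → Fin d → 𝔸ˣ)) i (fun x => ((a x : 𝔸ˣ) : 𝔸)) ((L : ℤ) • z) =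
        ((uavgZ L (1 : SiteZ d → Fin d → 𝔸ˣ) a i ((L : ℤ) • z) : 𝔸ˣ) : 𝔸) := by rw [hRa]
    have hbu : Rbar (zdBlockingZ d L) (bgTZ L (1 : SiteZ d → Fin d → 𝔸ˣ)) i (fun x => ((u x : 𝔸ˣ) : 𝔸)) ((L : ℤ) • z) =
        ((uavgZ L (1 : SiteZ d → Fin d → 𝔸ˣ) u i ((L : ℤ) • z) : 𝔸ˣ) : 𝔸) := by rw [hRu]
    rw [hbw, hba, hbu]
    -- the centre is a block site, so the induction hypothesis controls the base perturbation
    have hctr := IH' _ (smul_mem_blockSitesZ hL1 z)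
    rw [hRw, hRa, hRu] at hctr
    simp only [← Units.val_mul] at hctr
    have hctr' : ‖((uavgZ L (1 : SiteZ d → Fin d → 𝔸ˣ) a i ((L : ℤ) • z) * uavgZ L (1 : SiteZ d → Fin d → 𝔸ˣ) u i ((L : ℤ) • z) : 𝔸ˣ) : 𝔸) -
        ((uavgZ L (1 : SiteZ d → Fin d → 𝔸ˣ) (a * u) i ((L : ℤ) • z) : 𝔸ˣ) : 𝔸)‖ ≤ E i := by rw [norm_sub_rev]; exact hctr
    have hinv : ‖(((uavgZ L (1 : SiteZ d → Fin d → 𝔸ˣ) a i ((L : ℤ) • z) * uavgZ L (1 : SiteZ d → Fin d → 𝔸ˣ) u i ((L : ℤ) • z))⁻¹ : 𝔸ˣ) : 𝔸)‖ ≤ 1 := by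
      rw [mul_inv_rev, Units.val_mul]
      calc _ ≤ ‖(((uavgZ L (1 : SiteZ d → Fin d → 𝔸ˣ) u i ((L : ℤ) • z))⁻¹ : 𝔸ˣ) : 𝔸)‖ * ‖(((uavgZ L (1 : SiteZ d → Fin d → 𝔸ˣ) a i ((L : ℤ) • z))⁻¹ : 𝔸ˣ) : 𝔸)‖ :=
            norm_mul_le _ _
        _ ≤ 1 * 1 := by gcongr <;> first | exact hu1' i hij z hz | exact ha1' i hij z hz
        _ = 1 := one_mul 1
    have hsm_i := hsm i hij
    exact (norm_avgStep_sub_mul_le_of_near (blockSitesZ L z) (fun _ _ => by positivity) (sum_weights_blockSitesZ hL1 z)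
      (fun x _ => by rw [bgTZ_one]) _ _ _ (ha1 i hij z hz) (hu1 i hij z hz) (hu1' i hij z hz) (hw1' i hij z hz) _ _ _ (hp0 i) (hq0 i) (hEn i) hsm_i
      (fun x hx => by rw [hRa]; exact hp i hij z hz x hx) (fun x hx => by rw [hRu]; exact hq i hij z hz x hx)
      (norm_inv_mul_sub_one_le' hinv hctr) (norm_inv_mul_sub_one_le' (hw1' i hij z hz) hctr') IH').trans (hE i hij)

/-- ★★★ **THE GEOMETRIC SCHEDULE ON THE LOCALISED TOWER, AT THE CELL**: `‖R̄₀ʲ(a·u)(y) − R̄₀ʲa(y)·R̄₀ʲu(y)‖ ≤ 1024·s²`, uniformly in `j`, with the `U1` rows asked at the centres under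
`y` only. [cite: Balaban1985Averaging, (78)–(80) p.30; Balaban1987RG1, (0.3) p.252] -/
theorem rbar_one_mul_sub_mul_le_geom_local_at {L : ℕ} (hL : Odd L) (a u : SiteZ d → 𝔸ˣ) (j : ℕ) (y : SiteZ d) (p q : ℕ → ℝ) {s θ : ℝ}
    (hp0 : ∀ i, 0 ≤ p i) (hq0 : ∀ i, 0 ≤ q i) (hθ0 : 0 ≤ θ) (hθ2 : θ ≤ 1 / 2) (hs0 : 0 ≤ s) (hs32 : s ≤ 1 / 32) (hθs : 1024 * θ * s ≤ 1)
    (hpq : ∀ i, i < j → p i + q i ≤ s * θ ^ (j - (i + 1)))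
    (ha1 : ∀ i, i < j → ∀ z, UnderZ L (j - (i + 1)) y z → ‖((uavgZ L (1 : SiteZ d → Fin d → 𝔸ˣ) a i ((L : ℤ) • z) : 𝔸ˣ) : 𝔸)‖ ≤ 1)
    (hu1 : ∀ i, i < j → ∀ z, UnderZ L (j - (i + 1)) y z → ‖((uavgZ L (1 : SiteZ d → Fin d → 𝔸ˣ) u i ((L : ℤ) • z) : 𝔸ˣ) : 𝔸)‖ ≤ 1)
    (hu1' : ∀ i, i < j → ∀ z, UnderZ L (j - (i + 1)) y z → ‖(((uavgZ L (1 : SiteZ d → Fin d → 𝔸ˣ) u i ((L : ℤ) • z))⁻¹ : 𝔸ˣ) : 𝔸)‖ ≤ 1)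
    (hw1' : ∀ i, i < j → ∀ z, UnderZ L (j - (i + 1)) y z → ‖(((uavgZ L (1 : SiteZ d → Fin d → 𝔸ˣ) (a * u) i ((L : ℤ) • z))⁻¹ : 𝔸ˣ) : 𝔸)‖ ≤ 1)
    (ha1' : ∀ i, i < j → ∀ z, UnderZ L (j - (i + 1)) y z → ‖(((uavgZ L (1 : SiteZ d → Fin d → 𝔸ˣ) a i ((L : ℤ) • z))⁻¹ : 𝔸ˣ) : 𝔸)‖ ≤ 1)
    (hp : ∀ i, i < j → ∀ z, UnderZ L (j - (i + 1)) y z → ∀ x ∈ blockSitesZ L z,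
      ‖(((uavgZ L (1 : SiteZ d → Fin d → 𝔸ˣ) a i ((L : ℤ) • z))⁻¹ : 𝔸ˣ) : 𝔸) * ((uavgZ L (1 : SiteZ d → Fin d → 𝔸ˣ) a i x : 𝔸ˣ) : 𝔸) - 1‖ ≤ p i)
    (hq : ∀ i, i < j → ∀ z, UnderZ L (j - (i + 1)) y z → ∀ x ∈ blockSitesZ L z,
      ‖(((uavgZ L (1 : SiteZ d → Fin d → 𝔸ˣ) u i ((L : ℤ) • z))⁻¹ : 𝔸ˣ) : 𝔸) * ((uavgZ L (1 : SiteZ d → Fin d → 𝔸ˣ) u i x : 𝔸ˣ) : 𝔸) - 1‖ ≤ q i) :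
    ‖Rbar (zdBlockingZ d L) (bgTZ L (1 : SiteZ d → Fin d → 𝔸ˣ)) j (fun x => (((a * u) x : 𝔸ˣ) : 𝔸)) y -
      Rbar (zdBlockingZ d L) (bgTZ L (1 : SiteZ d → Fin d → 𝔸ˣ)) j (fun x => ((a x : 𝔸ˣ) : 𝔸)) y *
        Rbar (zdBlockingZ d L) (bgTZ L (1 : SiteZ d → Fin d → 𝔸ˣ)) j (fun x => ((u x : 𝔸ˣ) : 𝔸)) y‖ ≤ 1024 * s ^ 2 := by
  have hθ1 : θ ≤ 1 := hθ2.trans (by norm_num)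
  have h := rbar_one_mul_sub_mul_le_tower_local hL a u j y p q (fun i => 1024 * s ^ 2 * (θ ^ (2 * (j - i)) - θ ^ (2 * j))) hp0 hq0
    geomSchedule_zero (geomSchedule_nonneg hθ0 hθ1)
    (fun i hij => geomSchedule_step hθ0 hθ2 hs0 hθs hij (add_nonneg (hp0 i) (hq0 i)) (hpq i hij))
    (fun i hij => geomSchedule_small hθ0 hθ1 hs0 hs32 hθs hij (hpq i hij)) ha1 hu1 hu1' hw1' ha1' hp hq j le_rfl y
    (by rw [Nat.sub_self]; exact (underZ_zero_iff L y y).2 rfl)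
  exact h.trans (geomSchedule_le hθ0 hθ1 j)

/-- ★★ **ROAD (B′)'s ROW 9′ UP TO `ψ₂ := 1024·s²`, LOCALISED**: with `R̄₀ʲa(y) = 1` and `R̄₀ʲu(y) = 1`, `‖R̄₀ʲ(a·u)(y) − 1‖ ≤ 1024·s²`, the `U1` rows under the cell only.
[cite: Balaban1985Averaging, (78)–(81) p.30; Balaban1985RegularSpaces, (1.29) p.81; Balaban1987RG1, (0.3) p.252] -/
theorem norm_rbar_one_mul_sub_one_le_geom_local {L : ℕ} (hL : Odd L) (a u : SiteZ d → 𝔸ˣ) (j : ℕ) (y : SiteZ d) (p q : ℕ → ℝ) {s θ : ℝ}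
    (hp0 : ∀ i, 0 ≤ p i) (hq0 : ∀ i, 0 ≤ q i) (hθ0 : 0 ≤ θ) (hθ2 : θ ≤ 1 / 2) (hs0 : 0 ≤ s) (hs32 : s ≤ 1 / 32) (hθs : 1024 * θ * s ≤ 1)
    (hpq : ∀ i, i < j → p i + q i ≤ s * θ ^ (j - (i + 1)))
    (ha1 : ∀ i, i < j → ∀ z, UnderZ L (j - (i + 1)) y z → ‖((uavgZ L (1 : SiteZ d → Fin d → 𝔸ˣ) a i ((L : ℤ) • z) : 𝔸ˣ) : 𝔸)‖ ≤ 1)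
    (hu1 : ∀ i, i < j → ∀ z, UnderZ L (j - (i + 1)) y z → ‖((uavgZ L (1 : SiteZ d → Fin d → 𝔸ˣ) u i ((L : ℤ) • z) : 𝔸ˣ) : 𝔸)‖ ≤ 1)
    (hu1' : ∀ i, i < j → ∀ z, UnderZ L (j - (i + 1)) y z → ‖(((uavgZ L (1 : SiteZ d → Fin d → 𝔸ˣ) u i ((L : ℤ) • z))⁻¹ : 𝔸ˣ) : 𝔸)‖ ≤ 1)
    (hw1' : ∀ i, i < j → ∀ z, UnderZ L (j - (i + 1)) y z → ‖(((uavgZ L (1 : SiteZ d → Fin d → 𝔸ˣ) (a * u) i ((L : ℤ) • z))⁻¹ : 𝔸ˣ) : 𝔸)‖ ≤ 1)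
    (ha1' : ∀ i, i < j → ∀ z, UnderZ L (j - (i + 1)) y z → ‖(((uavgZ L (1 : SiteZ d → Fin d → 𝔸ˣ) a i ((L : ℤ) • z))⁻¹ : 𝔸ˣ) : 𝔸)‖ ≤ 1)
    (hp : ∀ i, i < j → ∀ z, UnderZ L (j - (i + 1)) y z → ∀ x ∈ blockSitesZ L z,
      ‖(((uavgZ L (1 : SiteZ d → Fin d → 𝔸ˣ) a i ((L : ℤ) • z))⁻¹ : 𝔸ˣ) : 𝔸) * ((uavgZ L (1 : SiteZ d → Fin d → 𝔸ˣ) a i x : 𝔸ˣ) : 𝔸) - 1‖ ≤ p i)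
    (hq : ∀ i, i < j → ∀ z, UnderZ L (j - (i + 1)) y z → ∀ x ∈ blockSitesZ L z,
      ‖(((uavgZ L (1 : SiteZ d → Fin d → 𝔸ˣ) u i ((L : ℤ) • z))⁻¹ : 𝔸ˣ) : 𝔸) * ((uavgZ L (1 : SiteZ d → Fin d → 𝔸ˣ) u i x : 𝔸ˣ) : 𝔸) - 1‖ ≤ q i)
    (ha : Rbar (zdBlockingZ d L) (bgTZ L (1 : SiteZ d → Fin d → 𝔸ˣ)) j (fun x => ((a x : 𝔸ˣ) : 𝔸)) y = 1)
    (hu : Rbar (zdBlockingZ d L) (bgTZ L (1 : SiteZ d → Fin d → 𝔸ˣ)) j (fun x => ((u x : 𝔸ˣ) : 𝔸)) y = 1) :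
    ‖Rbar (zdBlockingZ d L) (bgTZ L (1 : SiteZ d → Fin d → 𝔸ˣ)) j (fun x => (((a * u) x : 𝔸ˣ) : 𝔸)) y - 1‖ ≤ 1024 * s ^ 2 := by
  have h := rbar_one_mul_sub_mul_le_geom_local_at hL a u j y p q hp0 hq0 hθ0 hθ2 hs0 hs32 hθs hpq ha1 hu1 hu1' hw1' ha1' hp hq
  rwa [ha, hu, mul_one] at h

/-! ## §4  (v1.1) The `U1` rows UNDER THE CELL from unitarity and local (167)-smallness ([3] (22)–(23): skew-adjoint logarithms) -/

section Unitary

variable {𝔹 : Type*} [CStarAlgebra 𝔹]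

open B7Prop2Explicit (unitaryUnits mem_unitaryUnits star_mlog_eq_neg unitaryUnits_le_U1)
open BlockAveragingZd (offZ)
open B7SectCDGaugeAveragesRec (uavgZ_zero uavgZ_succ)

/-- ★★ **THE RECORD AVERAGES (79)–(80) OF A UNITARY GAUGE FUNCTION ARE UNITARY UNDER A CELL, FROM LOCAL (167)-SMALLNESS** (flat background, odd `L`): dag-n05-e's
`B7Prop8PrintedConstantsRec.uavgZ_mem_unitaryUnits` LOCALISED — if `u` is unitary at every site under the cell `y` (depth `j`) and the unguarded (78) families of its averages at the
centres `L·z` under `y` stay within `1∕4` of `1` (the junction's oscillation letters, `q_i ≤ 1∕4`), then `uavgZ L 1 u i z` is unitary for every `i ≤ j` and every `z` under `y` at depth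
`j − i` (each step is `ūⁱ(L·z)·exp[Σ L⁻ᵈ log(ūⁱ(L·z)⁻¹ūⁱ(L·z + r))]` with skew-adjoint logarithms, [3] (22)–(23)).  The global hypothesis of the original is NOT available to the
junction (its fields are unitary everywhere but (167)-small under the window only). [cite: Balaban1985Averaging, (78)–(80) p.30, (167) p.44, (22)–(23) p.21; Balaban1987RG1, (0.3)–(0.4) pp.252–253] -/
theorem uavgZ_one_mem_unitaryUnits_under {L : ℕ} (hL : Odd L) (u : SiteZ d → 𝔹ˣ) (j : ℕ) (y : SiteZ d)
    (hu : ∀ x, UnderZ L j y x → u x ∈ unitaryUnits 𝔹)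
    (h167 : ∀ i, i < j → ∀ z, UnderZ L (j - (i + 1)) y z → ∀ r : Fin d → Fin L,
      ‖((((uavgZ L (1 : SiteZ d → Fin d → 𝔹ˣ) u i ((L : ℤ) • z))⁻¹ *
          uavgZ L (1 : SiteZ d → Fin d → 𝔹ˣ) u i ((L : ℤ) • z + offZ L r) : 𝔹ˣ)) : 𝔹) - 1‖ ≤ 1 / 4) :
    ∀ i, i ≤ j → ∀ z, UnderZ L (j - i) y z → uavgZ L (1 : SiteZ d → Fin d → 𝔹ˣ) u i z ∈ unitaryUnits 𝔹 := by
  intro i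
  induction i with
  | zero => intro _ z hz; rw [uavgZ_zero]; rw [Nat.sub_zero] at hz; exact hu z hz
  | succ i ih =>
    intro hi z hz
    have hij : i < j := by omega
    have hdepth : j - (i + 1) + 1 = j - i := by omega
    -- the centre and the block points of `L·z` are under `y` at depth `j − i`
    have hctr : uavgZ L (1 : SiteZ d → Fin d → 𝔹ˣ) u i ((L : ℤ) • z) ∈ unitaryUnits 𝔹 := by
      obtain ⟨s, hs⟩ := hL
      have h := underZ_add ⟨s, hs⟩ hz (underZ_one_centre L z)
      rw [hdepth] at h
      exact ih hij.le _ h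
    have hblk : ∀ r : Fin d → Fin L, uavgZ L (1 : SiteZ d → Fin d → 𝔹ˣ) u i ((L : ℤ) • z + offZ L r) ∈ unitaryUnits 𝔹 := by
      intro r
      obtain ⟨s, hs⟩ := hL
      have h := underZ_add ⟨s, hs⟩ hz (underZ_one_block (by omega : L = 2 * s + 1) z r)
      rw [hdepth] at h
      exact ih hij.le _ h
    rw [mem_unitaryUnits, uavgZ_succ, B7SectCDGaugeAveragesRec.R0avgZ, BlockAveragingZd.avgIterZ_one, B7Eq99Concrete.R0fun_one_left]
    unfold B7SectCDGaugeAveragesRec.savgZ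
    rw [Units.val_mul, val_expUnit]
    refine Submonoid.mul_mem _ ((mem_unitaryUnits).1 hctr) ?_
    have hS : B7SectCDGaugeAveragesRec.SexpZ L (uavgZ L (1 : SiteZ d → Fin d → 𝔹ˣ) u i) ((L : ℤ) • z) ∈ skewAdjoint 𝔹 := by
      unfold B7SectCDGaugeAveragesRec.SexpZ
      refine sum_mem fun r _ => skewAdjoint.smul_mem _ ?_
      rw [skewAdjoint.mem_iff]
      refine star_mlog_eq_neg ?_ (h167 i hij z hz r)
      exact (mem_unitaryUnits).1 ((unitaryUnits 𝔹).mul_mem ((unitaryUnits 𝔹).inv_mem hctr) (hblk r))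
    letI : NormedAlgebra ℚ 𝔹 := NormedAlgebra.restrictScalars ℚ ℂ 𝔹
    exact NormedSpace.exp_mem_unitary_of_mem_skewAdjoint hS

/-- ★ **THE `U1` ROWS OF THE LOCALISED TOWER BOUND, FROM UNITARITY** (`‖1‖ = 1`): under the hypotheses of `uavgZ_one_mem_unitaryUnits_under`, at every centre `L·z` under the
cell, `‖ūⁱ(L·z)‖ ≤ 1` and `‖ūⁱ(L·z)⁻¹‖ ≤ 1` — the rows `ha1 ∕ ha1′` (resp. `hu1 ∕ hu1′`, `hw1′`) of `rbar_one_mul_sub_mul_le_tower_local` for that field.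
[cite: Balaban1985Averaging, (78)–(80) p.30, (167) p.44; Balaban1987RG1, (0.4) p.253] -/
theorem norm_uavgZ_one_le_one_under [Nontrivial 𝔹] {L : ℕ} (hL : Odd L) (u : SiteZ d → 𝔹ˣ) (j : ℕ) (y : SiteZ d)
    (hu : ∀ x, UnderZ L j y x → u x ∈ unitaryUnits 𝔹)
    (h167 : ∀ i, i < j → ∀ z, UnderZ L (j - (i + 1)) y z → ∀ r : Fin d → Fin L,
      ‖((((uavgZ L (1 : SiteZ d → Fin d → 𝔹ˣ) u i ((L : ℤ) • z))⁻¹ *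
          uavgZ L (1 : SiteZ d → Fin d → 𝔹ˣ) u i ((L : ℤ) • z + offZ L r) : 𝔹ˣ)) : 𝔹) - 1‖ ≤ 1 / 4) :
    ∀ i, i < j → ∀ z, UnderZ L (j - (i + 1)) y z →
      ‖((uavgZ L (1 : SiteZ d → Fin d → 𝔹ˣ) u i ((L : ℤ) • z) : 𝔹ˣ) : 𝔹)‖ ≤ 1 ∧
        ‖(((uavgZ L (1 : SiteZ d → Fin d → 𝔹ˣ) u i ((L : ℤ) • z))⁻¹ : 𝔹ˣ) : 𝔹)‖ ≤ 1 := by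
  intro i hij z hz
  have hdepth : j - (i + 1) + 1 = j - i := by omega
  obtain ⟨s, hs⟩ := hL
  have h := underZ_add ⟨s, hs⟩ hz (underZ_one_centre L z)
  rw [hdepth] at h
  have hmem := uavgZ_one_mem_unitaryUnits_under ⟨s, hs⟩ u j y hu h167 i hij.le _ h
  exact (B7Prop1Explicit.mem_U1).1 (unitaryUnits_le_U1 hmem)

end Unitary

end Literature.MathematicalPhysics.QuantumFieldTheory.Balaban1983to89.B8ExpMeanLogCrossTermGeomRec

end
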